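import Literature.NumberTheory.Sieve.SmoothArcClasses
import Literature.NumberTheory.Sieve.SmoothEndgameMinor
import Mathlib.Analysis.Normed.Group.InfiniteSum
import HarnessLib

/-!
# `W`-class profile weights: profile sums over friable integers (definitions, identities, bounds)

Topic `Literature/NumberTheory/Sieve`, namespace `Literature.NumberTheory.Sieve.SmoothArcs` (a PROVED tool file in
the smoothed circle method of [Harper2016, §5], companion of `SmoothArcClasses`, `SmoothEndgameMinor`,
`TwistedWeightMellin`).  Every analytic input of the smoothed circle method over the `y`-friable integers
`S(X, y)` is stated for the single twisted weights `W_λ(v) = v²(1−v)² e(λv)` (`twistWeight`) and their Mellin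
transforms `Ŵ_λ` (`twistMellin`), or for the plain weight `w(v) = v²(1−v)²` (`wt`, `smoothWeightSum`).  A
*`W`-class profile* is an absolutely convergent combination

`p_c(v) = Σ_{ℓ ∈ ℤ} c_ℓ W_ℓ(v) = v²(1−v)² Σ_ℓ c_ℓ e(ℓv)` on `(0,1]` (`0` elsewhere),

normed by `‖c‖_W = Σ_ℓ ‖c_ℓ‖ (1+|ℓ|)³` (`profileNorm`); plateau bumps `v²(1−v)² g(v)` with `g` smooth and
`1`-periodised belong to this class.  This file and its sequel `SmoothProfileSumsTransfer` transfer
single-weight statements to profiles.  Here: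

* definitions `profileFn`, `profileMellin` (`P̂_c(α; λ) = Σ_ℓ c_ℓ Ŵ_{λ+ℓ}(α)`), `profileNorm`,
  `classProfileSum X y m r c θ = Σ_{n ∈ S(X,y), n ≡ r (m)} p_c(n/X) e(nθ)`, and the summability /
  comparison API of the `W`-norm (`summable_norm_of_cube`, `tsum_norm_le_profileNorm`, …);
* (P1) `twistWeight_add`, `twistWeight_shift`, `profileFn_mul_fourierChar`:
  `W_{λ+ℓ}(v) = W_ℓ(v) e(λv)`, `p_c(v) e(λv) = Σ_ℓ c_ℓ W_{λ+ℓ}(v)`;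
* (P2) `classProfileSum_arc`: at `θ = h/k + λ/X`,
  `classProfileSum = Σ_ℓ c_ℓ · classArcSum X y m r k h (λ+ℓ)` (finite sum ⟷ series interchange);
* (P3) `norm_profileFn_le`, `norm_profileMellin_le` (`‖P̂_c(α;λ)‖ ≤ 2 Σ_ℓ‖c_ℓ‖(1+|ℓ|)/(1+|λ|)`, `0 < α ≤ 1`),
  `norm_twistMellin_sub_twistMellin_le` (`‖Ŵ_λ(s) − Ŵ_{λ'}(s)‖ ≤ 2π|λ−λ'|`) and the Lipschitz bound
  `norm_profileMellin_sub_le` (`‖P̂_c(α;λ) − P̂_c(α;λ')‖ ≤ 2π|λ−λ'| Σ_ℓ‖c_ℓ‖`);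
* (P5a) `classProfileSum_one_eq` (`m = 1`): `classProfileSum X y 1 0 c θ = Σ_ℓ c_ℓ S_w(θ + ℓ/X; X)`.

The major-arc transfer (P4), the minor-arc transfer (P5) and the parity split (P6) are in
`SmoothProfileSumsTransfer`.

## References

* A. J. Harper, Compositio Math. 152 (2016), §5 (smooth weights on the major and minor arcs) [Harper2016].
-/

noncomputable section

open Finset Real Complex MeasureTheory
open scoped FourierTransform

namespace Literature.NumberTheory.Sieve

namespace SmoothArcs

open TwistedWeight Endgame

/-! ### Definitions -/

/-- A W-CLASS PROFILE: `p_c(v) = Σ_ℓ c_ℓ W_ℓ(v)` (`= v²(1−v)² Σ_ℓ c_ℓ e(ℓv)` on `(0,1]`, `0` elsewhere).  A `tsum`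
(junk value `0` if the series diverges); all uses assume `Σ_ℓ ‖c_ℓ‖ < ∞`, and then `hasSum_profileFn`.
[cite: Harper2016, §5] -/
def profileFn (c : ℤ → ℂ) (v : ℝ) : ℂ := ∑' ℓ : ℤ, c ℓ * twistWeight (ℓ : ℝ) v

/-- Its twisted Mellin transform on the line: `P̂_c(α; λ) = Σ_ℓ c_ℓ Ŵ_{λ+ℓ}(α)` (`= ∫₀¹ p_c(v) v^{α−1} e(λv) dv`;
a `tsum`, convergent for `Re α ≥ 0` when `Σ_ℓ ‖c_ℓ‖ < ∞` since `‖Ŵ‖ ≤ 1`, `summable_mul_twistMellin`).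
[cite: Harper2016, §5] -/
def profileMellin (c : ℤ → ℂ) (α lam : ℝ) : ℂ := ∑' ℓ : ℤ, c ℓ * twistMellin (lam + ℓ) (α : ℂ)

/-- The W-class norm `‖c‖_W = Σ_ℓ ‖c_ℓ‖ (1+|ℓ|)³` (a `tsum` of nonnegative reals: junk value `0` when the series
diverges; the transfer lemmas assume it converges). [folklore] -/
def profileNorm (c : ℤ → ℂ) : ℝ := ∑' ℓ : ℤ, ‖c ℓ‖ * (1 + |(ℓ : ℝ)|) ^ 3

/-- Class-restricted profile sum `Σ_{n ∈ S(X,y), n ≡ r (mod m)} p_c(n/X) e(nθ)` (intended for `m ≥ 1`; as for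
`classArcSum`, for `m = 0` the class condition reads `n = r`). [cite: Harper2016, §5] -/
def classProfileSum (X : ℝ) (y m r : ℕ) (c : ℤ → ℂ) (θ : ℝ) : ℂ :=
  ∑ n ∈ (Nat.smoothNumbersUpTo ⌊X⌋₊ (y + 1)).filter (fun n => n ≡ r [MOD m]), profileFn c (n / X) * (𝐞 ((n : ℝ) * θ) : ℂ)

variable {c : ℤ → ℂ}

/-! ### The `W`-norm and summability -/

/-- `‖c_ℓ‖ ≤ ‖c_ℓ‖(1+|ℓ|)³`. [folklore] -/
theorem norm_le_norm_mul_cube (c : ℤ → ℂ) (ℓ : ℤ) : ‖c ℓ‖ ≤ ‖c ℓ‖ * (1 + |(ℓ : ℝ)|) ^ 3 := by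
  have h1 : (1 : ℝ) ≤ (1 + |(ℓ : ℝ)|) ^ 3 := one_le_pow₀ (by linarith [abs_nonneg (ℓ : ℝ)])
  nlinarith [norm_nonneg (c ℓ)]

/-- `‖c_ℓ‖(1+|ℓ|) ≤ ‖c_ℓ‖(1+|ℓ|)³`. [folklore] -/
theorem norm_mul_le_norm_mul_cube (c : ℤ → ℂ) (ℓ : ℤ) :
    ‖c ℓ‖ * (1 + |(ℓ : ℝ)|) ≤ ‖c ℓ‖ * (1 + |(ℓ : ℝ)|) ^ 3 := by
  refine mul_le_mul_of_nonneg_left ?_ (norm_nonneg _)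
  calc (1 + |(ℓ : ℝ)|) = (1 + |(ℓ : ℝ)|) ^ 1 := (pow_one _).symm
    _ ≤ (1 + |(ℓ : ℝ)|) ^ 3 := pow_le_pow_right₀ (by linarith [abs_nonneg (ℓ : ℝ)]) (by norm_num)

/-- `Σ_ℓ ‖c_ℓ‖ < ∞` when `‖c‖_W < ∞`. [folklore] -/
theorem summable_norm_of_cube (hc : Summable (fun ℓ : ℤ => ‖c ℓ‖ * (1 + |(ℓ : ℝ)|) ^ 3)) :
    Summable (fun ℓ : ℤ => ‖c ℓ‖) :=
  Summable.of_nonneg_of_le (fun _ => norm_nonneg _) (norm_le_norm_mul_cube c) hc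

/-- `Σ_ℓ ‖c_ℓ‖(1+|ℓ|) < ∞` when `‖c‖_W < ∞`. [folklore] -/
theorem summable_norm_mul_of_cube (hc : Summable (fun ℓ : ℤ => ‖c ℓ‖ * (1 + |(ℓ : ℝ)|) ^ 3)) :
    Summable (fun ℓ : ℤ => ‖c ℓ‖ * (1 + |(ℓ : ℝ)|)) :=
  Summable.of_nonneg_of_le (fun ℓ => by positivity) (norm_mul_le_norm_mul_cube c) hc

/-- `0 ≤ ‖c‖_W`. [folklore] -/
theorem profileNorm_nonneg (c : ℤ → ℂ) : 0 ≤ profileNorm c :=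
  tsum_nonneg fun ℓ => by positivity

/-- `Σ_ℓ ‖c_ℓ‖ ≤ ‖c‖_W`. [folklore] -/
theorem tsum_norm_le_profileNorm (hc : Summable (fun ℓ : ℤ => ‖c ℓ‖ * (1 + |(ℓ : ℝ)|) ^ 3)) :
    ∑' ℓ : ℤ, ‖c ℓ‖ ≤ profileNorm c :=
  Summable.tsum_le_tsum (norm_le_norm_mul_cube c) (summable_norm_of_cube hc) hc

/-- `Σ_ℓ ‖c_ℓ‖(1+|ℓ|) ≤ ‖c‖_W`. [folklore] -/
theorem tsum_norm_mul_le_profileNorm (hc : Summable (fun ℓ : ℤ => ‖c ℓ‖ * (1 + |(ℓ : ℝ)|) ^ 3)) :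
    ∑' ℓ : ℤ, ‖c ℓ‖ * (1 + |(ℓ : ℝ)|) ≤ profileNorm c :=
  Summable.tsum_le_tsum (norm_mul_le_norm_mul_cube c) (summable_norm_mul_of_cube hc) hc

/-- Each `ℓ ↦ c_ℓ W_{λ+ℓ}(v)` is summable (`‖W‖ ≤ 1`). [folklore] -/
theorem summable_mul_twistWeight (hc' : Summable (fun ℓ : ℤ => ‖c ℓ‖)) (lam v : ℝ) :
    Summable (fun ℓ : ℤ => c ℓ * twistWeight (lam + ℓ) v) := by
  refine Summable.of_norm_bounded hc' (fun ℓ => ?_)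
  rw [norm_mul]
  calc ‖c ℓ‖ * ‖twistWeight (lam + ℓ) v‖ ≤ ‖c ℓ‖ * 1 :=
        mul_le_mul_of_nonneg_left (norm_twistWeight_le _ _) (norm_nonneg _)
    _ = ‖c ℓ‖ := mul_one _

/-- Each `ℓ ↦ c_ℓ Ŵ_{λ+ℓ}(s)` is summable for `Re s ≥ 0` (`‖Ŵ‖ ≤ 1`). [folklore] -/
theorem summable_mul_twistMellin (hc' : Summable (fun ℓ : ℤ => ‖c ℓ‖)) {s : ℂ} (hs : 0 ≤ s.re) (lam : ℝ) :
    Summable (fun ℓ : ℤ => c ℓ * twistMellin (lam + ℓ) s) := by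
  refine Summable.of_norm_bounded hc' (fun ℓ => ?_)
  rw [norm_mul]
  calc ‖c ℓ‖ * ‖twistMellin (lam + ℓ) s‖ ≤ ‖c ℓ‖ * 1 :=
        mul_le_mul_of_nonneg_left (norm_twistMellin_le_one hs _) (norm_nonneg _)
    _ = ‖c ℓ‖ := mul_one _

/-- `p_c = 0` off `(0,1]`. [folklore] -/
theorem profileFn_of_not_mem {v : ℝ} (hv : v ∉ Set.Ioc (0 : ℝ) 1) (c : ℤ → ℂ) : profileFn c v = 0 := by
  unfold profileFn
  simp_rw [twistWeight_of_not_mem hv, mul_zero, tsum_zero]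

/-- The series defining `p_c(v)` converges to it when `Σ‖c_ℓ‖ < ∞`. [folklore] -/
theorem hasSum_profileFn (hc' : Summable (fun ℓ : ℤ => ‖c ℓ‖)) (v : ℝ) :
    HasSum (fun ℓ : ℤ => c ℓ * twistWeight (ℓ : ℝ) v) (profileFn c v) := by
  have h := summable_mul_twistWeight hc' 0 v
  simp_rw [zero_add] at h
  exact h.hasSum

/-! ### (P1) Shifting the frequency -/

/-- `W_{λ+μ}(v) = W_λ(v) e(μv)`. [folklore] -/
theorem twistWeight_add (lam mu v : ℝ) : twistWeight (lam + mu) v = twistWeight lam v * 𝐞 (mu * v) := by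
  by_cases hv : v ∈ Set.Ioc (0 : ℝ) 1
  · rw [twistWeight_of_mem hv, twistWeight_of_mem hv, add_mul, AddChar.map_add_eq_mul, Circle.coe_mul, mul_assoc]
  · rw [twistWeight_of_not_mem hv, twistWeight_of_not_mem hv, zero_mul]

/-- `W_{λ+ℓ}(v) = W_ℓ(v) e(λv)`. [folklore] -/
theorem twistWeight_shift (lam mu v : ℝ) : twistWeight (lam + mu) v = twistWeight mu v * 𝐞 (lam * v) := by
  rw [add_comm, twistWeight_add]

/-- `p_c(v) e(λv) = Σ_ℓ c_ℓ W_{λ+ℓ}(v)`. [folklore] -/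
theorem profileFn_mul_fourierChar (c : ℤ → ℂ) (lam v : ℝ) :
    profileFn c v * 𝐞 (lam * v) = ∑' ℓ : ℤ, c ℓ * twistWeight (lam + ℓ) v := by
  rw [profileFn, ← tsum_mul_right]
  refine tsum_congr fun ℓ => ?_
  rw [mul_assoc, ← twistWeight_shift]

/-! ### (P2) The profile sum on an arc as a series of single-weight arc sums -/

/-- **Arc identity.** At `θ = h/k + λ/X`:
`classProfileSum X y m r c θ = Σ_ℓ c_ℓ · classArcSum X y m r k h (λ + ℓ)`
(`e(nθ) = e(hn/k) e(λ n/X)`, then interchange the finite `n`-sum with the `ℓ`-series). [folklore] -/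
theorem classProfileSum_arc (hc' : Summable (fun ℓ : ℤ => ‖c ℓ‖)) (X : ℝ) (y m r k : ℕ) (h : ℤ) (lam : ℝ) :
    classProfileSum X y m r c ((h : ℝ) / k + lam / X) = ∑' ℓ : ℤ, c ℓ * classArcSum X y m r k h (lam + ℓ) := by
  unfold classProfileSum classArcSum
  set S := (Nat.smoothNumbersUpTo ⌊X⌋₊ (y + 1)).filter (fun n => n ≡ r [MOD m])
  have h1 : ∀ n ∈ S, profileFn c (n / X) * (𝐞 ((n : ℝ) * ((h : ℝ) / k + lam / X)) : ℂ) =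
      ∑' ℓ : ℤ, c ℓ * ((𝐞 ((h * n : ℝ) / k) : ℂ) * twistWeight (lam + ℓ) (n / X)) := by
    intro n _
    have e1 : (n : ℝ) * ((h : ℝ) / k + lam / X) = (h * n : ℝ) / k + lam * (n / X) := by ring
    rw [e1, AddChar.map_add_eq_mul, Circle.coe_mul, mul_left_comm, profileFn_mul_fourierChar, ← tsum_mul_left]
    exact tsum_congr fun ℓ => by ring
  rw [Finset.sum_congr rfl h1, ← Summable.tsum_finsetSum]
  · refine tsum_congr fun ℓ => ?_
    rw [Finset.mul_sum]
  · intro n _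
    refine Summable.of_norm_bounded hc' (fun ℓ => ?_)
    rw [norm_mul, norm_mul, Circle.norm_coe, one_mul]
    calc ‖c ℓ‖ * ‖twistWeight (lam + ℓ) (n / X)‖ ≤ ‖c ℓ‖ * 1 :=
          mul_le_mul_of_nonneg_left (norm_twistWeight_le _ _) (norm_nonneg _)
      _ = ‖c ℓ‖ := mul_one _

/-! ### (P3) Bounds for `p_c` and `P̂_c` -/

/-- `‖p_c(v)‖ ≤ Σ_ℓ ‖c_ℓ‖`. [folklore] -/
theorem norm_profileFn_le (hc' : Summable (fun ℓ : ℤ => ‖c ℓ‖)) (v : ℝ) : ‖profileFn c v‖ ≤ ∑' ℓ : ℤ, ‖c ℓ‖ := by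
  refine tsum_of_norm_bounded hc'.hasSum (fun ℓ => ?_)
  rw [norm_mul]
  calc ‖c ℓ‖ * ‖twistWeight (ℓ : ℝ) v‖ ≤ ‖c ℓ‖ * 1 :=
        mul_le_mul_of_nonneg_left (norm_twistWeight_le _ _) (norm_nonneg _)
    _ = ‖c ℓ‖ := mul_one _

/-- `‖Ŵ_λ(α)‖ ≤ 2/(1+|λ|)` for `0 < α ≤ 1` (the case `t = 0` of `norm_twistMellin_le_two_div`). [folklore] -/
theorem norm_twistMellin_ofReal_le {α : ℝ} (hα : 0 < α) (hα1 : α ≤ 1) (lam : ℝ) :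
    ‖twistMellin lam (α : ℂ)‖ ≤ 2 / (1 + |lam|) := by
  have h := norm_twistMellin_le_two_div hα hα1 (t := 0) (by rw [abs_zero]; norm_num) lam
  rwa [Complex.ofReal_zero, zero_mul, add_zero] at h

/-- **`‖P̂_c(α; λ)‖ ≤ 2 Σ_ℓ ‖c_ℓ‖(1+|ℓ|) / (1+|λ|)`** for `0 < α ≤ 1`
(`‖Ŵ_{λ+ℓ}(α)‖ ≤ 2/(1+|λ+ℓ|) ≤ 2(1+|ℓ|)/(1+|λ|)`). [folklore] -/
theorem norm_profileMellin_le (hcW : Summable (fun ℓ : ℤ => ‖c ℓ‖ * (1 + |(ℓ : ℝ)|))) {α : ℝ} (hα : 0 < α)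
    (hα1 : α ≤ 1) (lam : ℝ) :
    ‖profileMellin c α lam‖ ≤ 2 * (∑' ℓ : ℤ, ‖c ℓ‖ * (1 + |(ℓ : ℝ)|)) / (1 + |lam|) := by
  have hpos : 0 < 1 + |lam| := by positivity
  rw [mul_div_assoc, div_eq_inv_mul _ (1 + |lam|), ← mul_assoc]
  refine tsum_of_norm_bounded (hcW.hasSum.mul_left (2 * (1 + |lam|)⁻¹)) (fun ℓ => ?_)
  rw [norm_mul]
  have h1 : ‖twistMellin (lam + ℓ) (α : ℂ)‖ ≤ 2 / (1 + |lam + ℓ|) := norm_twistMellin_ofReal_le hα hα1 _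
  -- `1 + |λ| ≤ (1 + |λ+ℓ|)(1 + |ℓ|)` (also `ZetaSqReflectionPrinciple.one_add_abs_le_mul`, not imported here)
  have hkey : 1 + |lam| ≤ (1 + |lam + ℓ|) * (1 + |(ℓ : ℝ)|) := by
    have h3 : |lam| ≤ |lam + ℓ| + |(ℓ : ℝ)| := by
      have h4 := abs_add_le (lam + ℓ) (-(ℓ : ℝ))
      rwa [add_neg_cancel_right, abs_neg] at h4
    nlinarith [abs_nonneg (lam + ℓ), abs_nonneg (ℓ : ℝ), mul_nonneg (abs_nonneg (lam + ℓ)) (abs_nonneg (ℓ : ℝ))]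
  have h2 : 2 / (1 + |lam + ℓ|) ≤ 2 * (1 + |lam|)⁻¹ * (1 + |(ℓ : ℝ)|) := by
    rw [← div_eq_mul_inv, div_mul_eq_mul_div, div_le_div_iff₀ (by positivity) hpos]
    nlinarith [hkey]
  calc ‖c ℓ‖ * ‖twistMellin (lam + ℓ) (α : ℂ)‖ ≤ ‖c ℓ‖ * (2 * (1 + |lam|)⁻¹ * (1 + |(ℓ : ℝ)|)) :=
        mul_le_mul_of_nonneg_left (h1.trans h2) (norm_nonneg _)
    _ = 2 * (1 + |lam|)⁻¹ * (‖c ℓ‖ * (1 + |(ℓ : ℝ)|)) := by ring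

/-- `‖p_c(v)‖ ≤ ‖c‖_W`. [folklore] -/
theorem norm_profileFn_le_profileNorm (hc : Summable (fun ℓ : ℤ => ‖c ℓ‖ * (1 + |(ℓ : ℝ)|) ^ 3)) (v : ℝ) :
    ‖profileFn c v‖ ≤ profileNorm c :=
  (norm_profileFn_le (summable_norm_of_cube hc) v).trans (tsum_norm_le_profileNorm hc)

/-- `‖P̂_c(α; λ)‖ ≤ 2‖c‖_W/(1+|λ|)` for `0 < α ≤ 1`. [folklore] -/
theorem norm_profileMellin_le_profileNorm (hc : Summable (fun ℓ : ℤ => ‖c ℓ‖ * (1 + |(ℓ : ℝ)|) ^ 3)) {α : ℝ}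
    (hα : 0 < α) (hα1 : α ≤ 1) (lam : ℝ) : ‖profileMellin c α lam‖ ≤ 2 * profileNorm c / (1 + |lam|) := by
  refine (norm_profileMellin_le (summable_norm_mul_of_cube hc) hα hα1 lam).trans ?_
  have hpos : 0 < 1 + |lam| := by positivity
  rw [div_le_div_iff_of_pos_right hpos]
  exact mul_le_mul_of_nonneg_left (tsum_norm_mul_le_profileNorm hc) zero_le_two

/-- **`‖Ŵ_λ(s) − Ŵ_{λ'}(s)‖ ≤ 2π|λ − λ'|`** for `Re s ≥ 0` (the integrand is `v^{s+1}(1−v)²(e(λv) − e(λ'v))`,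
of norm `≤ 2π|λ−λ'| v ≤ 2π|λ−λ'|`). [folklore] -/
theorem norm_twistMellin_sub_twistMellin_le {s : ℂ} (hs : 0 ≤ s.re) (lam lam' : ℝ) :
    ‖twistMellin lam s - twistMellin lam' s‖ ≤ 2 * π * |lam - lam'| := by
  unfold twistMellin
  have hz : 0 < (s + 1).re := by simp; linarith
  rw [← intervalIntegral.integral_sub (intervalIntegrable_integrand hz lam) (intervalIntegrable_integrand hz lam')]
  calc ‖∫ v in (0 : ℝ)..1, ((v : ℂ) ^ (s + 1) * ((((1 - v) ^ 2 : ℝ)) : ℂ) * (𝐞 (lam * v) : ℂ) -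
        (v : ℂ) ^ (s + 1) * ((((1 - v) ^ 2 : ℝ)) : ℂ) * (𝐞 (lam' * v) : ℂ))‖
      ≤ 2 * π * |lam - lam'| * |(1 : ℝ) - 0| := by
        refine intervalIntegral.norm_integral_le_of_norm_le_const fun v hv => ?_
        rw [Set.uIoc_of_le zero_le_one, Set.mem_Ioc] at hv
        obtain ⟨hv0, hv1⟩ := hv
        rw [← mul_sub, norm_mul]
        have h1 : ‖(v : ℂ) ^ (s + 1) * ((((1 - v) ^ 2 : ℝ)) : ℂ)‖ ≤ 1 := by
          have h := norm_integrand_le hs hv0.le hv1 0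
          rwa [norm_mul (_ * _), Circle.norm_coe, mul_one] at h
        -- `|e(s) − e(t)| ≤ 2π|s − t|` (cf. `CircleMethodKernel`, `MoebiusWalshSparseDyadic.norm_fourierChar_sub_le`,
        -- neither in this file's import closure), at `s = λv`, `t = λ'v`, and `|λv − λ'v| ≤ |λ − λ'|`
        have h2 : ‖(𝐞 (lam * v) : ℂ) - 𝐞 (lam' * v)‖ ≤ 2 * π * |lam - lam'| := by
          have h3 : (𝐞 (lam * v) : ℂ) - 𝐞 (lam' * v) = (𝐞 (lam' * v) : ℂ) * ((𝐞 (lam * v - lam' * v) : ℂ) - 1) := by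
            rw [mul_sub, mul_one, ← Circle.coe_mul, ← AddChar.map_add_eq_mul, add_sub_cancel]
          rw [h3, norm_mul, Circle.norm_coe, one_mul, Real.fourierChar_apply, mul_comm _ Complex.I]
          refine (Real.norm_exp_I_mul_ofReal_sub_one_le).trans ?_
          rw [Real.norm_eq_abs, abs_mul, abs_of_pos Real.two_pi_pos, ← sub_mul, abs_mul, abs_of_pos hv0]
          have : |lam - lam'| * v ≤ |lam - lam'| := mul_le_of_le_one_right (abs_nonneg _) hv1
          nlinarith [Real.pi_pos]
        calc ‖(v : ℂ) ^ (s + 1) * ((((1 - v) ^ 2 : ℝ)) : ℂ)‖ * ‖(𝐞 (lam * v) : ℂ) - 𝐞 (lam' * v)‖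
            ≤ 1 * (2 * π * |lam - lam'|) := mul_le_mul h1 h2 (norm_nonneg _) zero_le_one
          _ = 2 * π * |lam - lam'| := one_mul _
    _ = 2 * π * |lam - lam'| := by norm_num

/-- **Lipschitz bound in `λ`**: `‖P̂_c(α;λ) − P̂_c(α;λ')‖ ≤ 2π|λ − λ'| Σ_ℓ ‖c_ℓ‖` (`α ≥ 0`). [folklore] -/
theorem norm_profileMellin_sub_le (hc' : Summable (fun ℓ : ℤ => ‖c ℓ‖)) {α : ℝ} (hα : 0 ≤ α) (lam lam' : ℝ) :
    ‖profileMellin c α lam - profileMellin c α lam'‖ ≤ 2 * π * |lam - lam'| * ∑' ℓ : ℤ, ‖c ℓ‖ := by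
  have hs : 0 ≤ ((α : ℂ)).re := by simpa using hα
  unfold profileMellin
  rw [← Summable.tsum_sub (summable_mul_twistMellin hc' hs lam) (summable_mul_twistMellin hc' hs lam')]
  refine tsum_of_norm_bounded (hc'.hasSum.mul_left (2 * π * |lam - lam'|)) (fun ℓ => ?_)
  rw [← mul_sub, norm_mul, mul_comm]
  refine mul_le_mul_of_nonneg_right ?_ (norm_nonneg _)
  have h := norm_twistMellin_sub_twistMellin_le hs (lam + ℓ) (lam' + ℓ)
  rwa [add_sub_add_right_eq_sub] at h

/-! ### (P5a) The case `m = 1`: a series of plain smooth-weighted sums -/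

/-- Members of `S(X, y)` satisfy `0 < n/X ≤ 1`. [folklore] -/
theorem div_mem_Ioc_of_mem {X : ℝ} {y n : ℕ} (hn : n ∈ Nat.smoothNumbersUpTo ⌊X⌋₊ (y + 1)) :
    (n : ℝ) / X ∈ Set.Ioc (0 : ℝ) 1 := by
  rw [Nat.mem_smoothNumbersUpTo] at hn
  have hn0 : 0 < n := Nat.pos_of_ne_zero (Nat.ne_zero_of_mem_smoothNumbers hn.2)
  have hX : 1 ≤ X := Nat.floor_pos.mp (lt_of_lt_of_le hn0 hn.1)
  have hX0 : 0 < X := by linarith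
  have hnX : (n : ℝ) ≤ X := (Nat.le_floor_iff hX0.le).mp hn.1
  exact ⟨div_pos (by exact_mod_cast hn0) hX0, (div_le_one hX0).mpr hnX⟩

/-- `W_ℓ(n/X) = w(n/X) e(ℓ n/X)` for `n ∈ S(X, y)`. [folklore] -/
theorem twistWeight_div_of_mem {X : ℝ} {y n : ℕ} (hn : n ∈ Nat.smoothNumbersUpTo ⌊X⌋₊ (y + 1)) (lam : ℝ) :
    twistWeight lam (n / X) = (wt (n / X) : ℂ) * (𝐞 (lam * (n / X)) : ℂ) := by
  rw [twistWeight_of_mem (div_mem_Ioc_of_mem hn), wt]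

/-- **`m = 1`: the profile sum as a series of plain smooth-weighted sums**,
`classProfileSum X y 1 0 c θ = Σ_ℓ c_ℓ S_w(θ + ℓ/X; X)`. [folklore] -/
theorem classProfileSum_one_eq (hc' : Summable (fun ℓ : ℤ => ‖c ℓ‖)) (X : ℝ) (y : ℕ) (θ : ℝ) :
    classProfileSum X y 1 0 c θ = ∑' ℓ : ℤ, c ℓ * smoothWeightSum X y (θ + ℓ / X) := by
  unfold classProfileSum smoothWeightSum
  rw [Finset.filter_true_of_mem (fun n _ => (Nat.modEq_one : n ≡ 0 [MOD 1]))]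
  set S := Nat.smoothNumbersUpTo ⌊X⌋₊ (y + 1)
  have h1 : ∀ n ∈ S, profileFn c (n / X) * (𝐞 ((n : ℝ) * θ) : ℂ) =
      ∑' ℓ : ℤ, c ℓ * ((wt (n / X) : ℂ) * (𝐞 ((n : ℝ) * (θ + ℓ / X)) : ℂ)) := by
    intro n hn
    rw [profileFn, ← tsum_mul_right]
    refine tsum_congr fun ℓ => ?_
    rw [twistWeight_div_of_mem hn, mul_assoc, mul_assoc, ← Circle.coe_mul, ← AddChar.map_add_eq_mul]
    congr 4
    ring
  rw [Finset.sum_congr rfl h1, ← Summable.tsum_finsetSum]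
  · refine tsum_congr fun ℓ => ?_
    rw [Finset.mul_sum]
  · intro n hn
    refine Summable.of_norm_bounded hc' (fun ℓ => ?_)
    have hw : ‖(wt (n / X) : ℂ)‖ ≤ 1 := by
      obtain ⟨h0, h1⟩ := div_mem_Ioc_of_mem hn
      rw [Complex.norm_real, Real.norm_eq_abs, abs_of_nonneg (wt_nonneg _)]
      exact wt_le_one h0.le h1
    rw [norm_mul, norm_mul, Circle.norm_coe, mul_one]
    calc ‖c ℓ‖ * ‖(wt (n / X) : ℂ)‖ ≤ ‖c ℓ‖ * 1 := mul_le_mul_of_nonneg_left hw (norm_nonneg _)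
      _ = ‖c ℓ‖ := mul_one _

end SmoothArcs

end Literature.NumberTheory.Sieve

end
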